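import Literature.AlgebraicGeometry.Frobenioids.ArchimedeanPointBaseProp35N
import Literature.AlgebraicGeometry.Frobenioids.ArchimedeanProp35iiiStdCounterexample
import Literature.AlgebraicGeometry.Frobenioids.ArchimedeanProp35iiiCounterexample
import HarnessLib

/-!
# Frobenioids II, Proposition 3.5 (iii): the REPAIRED statement (Galois-saturated reading), typed and proved,
# with the refuting bases shown to miss exactly the repaired hypothesis

Mochizuki, *The geometry of Frobenioids II: poly-Frobenioids*, Kyushu J. Math. **62** (2008) 401–460, §3,
Proposition 3.5 (iii), kurims p. 34 (journal p. 430): "Suppose further that `D` is of RC-iso-subanchor type. Then …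
(iii) `G` [`= N`, `R`] is of RC-iso-subanchor type"; Definition 3.1 (v) p. 25 (RC-iso-subanchor: "a mono-minimal
categorical quotient `B → A` of an RC-subanchor `B` by a subgroup `G ⊆ Aut(B)`")
[cite: MochizukiFrdII2008, Prop 3.5 (iii) p.34] [cite: MochizukiFrdII2008, Def 3.1 (v) p.25].

STATEMENT + PROOF file (abc-iut cell, layer L1, DAG node `FrdII:Prop3.5(iii)`, chain LC-L1-2 — OUTSIDE the
[IUTchIII] Cor. 3.12 cone; seat abc-iut-w4-d027 gen 4, the node's holder lineage). KERNEL RECORD SO FAR: the typed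
instance `ArchFrd.Prop35iii_N π` (abc-iut-L1-t9) is REFUTED AS TYPED = AS PRINTED — at the Galois-collapsing base
`D₀ → D₀` (gen 2, `not_prop35iii_N_collapse`) and at the base `S → D₀` of RC-STANDARD type meeting every printed
hypothesis of [FrdII] §3–§4 (gen 3, `P35iiiStd.not_prop35iii_N_std`; abc-iut-L1-t9 gen 3 p430021 adds «of
discontinuously ordered type»); root: the printed proof of (i), p. 34, tacitly needs the quotient presentations
`(B_D → A_D, G_D)` to be GALOIS-SATURATED (abc-iut-w4-d100's `ArchFrd.GaloisSaturated`: some `g ∈ G_D` maps to complex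
conjugation when `B_D` is complex over a real `A_D`). abc-iut-L1-lead R123 (5), 2026-08-26T07:23Z: «class
misstated/under-hypothesised for arbitrary base functors; the Galois-saturated reading stays open/untyped».

This file TYPES that reading as a named statement and closes it (misstated-fact protocol: repaired statement C′ +
`_holds` + «the witnesses miss C′»):

* **`IsOfSaturatedRCIsoSubanchorType π`** (a `Prop`-valued structure, like `RC.IsOfRCIsoSubanchorType`) — the repaired hypothesis C′-hyp: every object of `D` is a mono-minimal
  categorical quotient of an RC-subanchor by a GALOIS-SATURATED subgroup (the printed Def. 3.1 (v)(d) plus the tacit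
  saturation); `…iff_real`: equivalently, `D` is of RC-iso-subanchor type and its REAL objects admit saturated
  presentations (over complex objects saturation is void, `galoisSaturated_of_isComplex`);
* **`Prop35iiiR_N π` / `Prop35iiiR_R π`** — Prop. 3.5 (iii) for `G = N`, `R` with hypothesis C′-hyp — and
  **`prop35iiiR_N_holds`**, **`prop35iiiR_R_holds`**: BOTH PROVED for every base functor `π : D → D₀` (gen 2's
  `prop35iii_N_of_saturated` / `prop35iii_R_holds`); `prop35iii_N_of_isOfSaturatedRCIsoSubanchorType`: C′-hyp implies
  the typed (iii) outright;
* **the refuting witnesses miss C′-hyp exactly**: `not_isOfSaturatedRCIsoSubanchorType_of_not_prop35iii_N` (any base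
  refuting the typed (iii) is not of saturated type), whence **`P35iiiStd.not_isOfSaturatedRCIsoSubanchorType`** (the
  RC-standard base `S`) and **`D0.not_isOfSaturatedRCIsoSubanchorType_collapse`** (the collapse base) — while the
  RC-standard base `T → D₀` of abc-iut-w5-d013, at which the typed (i) FAILS, IS of saturated type
  (**`P35iToy.isOfSaturatedRCIsoSubanchorType_toD0`**), as is every base with purely complex image
  (`isOfSaturatedRCIsoSubanchorType_of_forall_isComplex`) and THE base of [IUTchI] Ex. 3.4 (i)
  (**`isOfSaturatedRCIsoSubanchorType_ptBase`**). [Every FAITHFUL base functor of RC-iso-subanchor type is of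
  saturated type by abc-iut-w4-d100's `galoisSaturated_of_faithful` — recorded in the companion
  `ArchimedeanProp35FaithfulBases.lean` once that module's olean exists.]

So the kernel record for node `FrdII:Prop3.5(iii)` [N] reads: REFUTED-MISSTATED — false as typed/printed for
arbitrary base functors; TRUE under the Galois-saturated reading C′ (this file), which the refuting bases violate
and the bases that occur (complex-image, faithful, `ptBase`) satisfy. No new Prop FACT is introduced (both repaired
statements are theorems here); nothing in this file bears on [IUTchIII] Cor. 3.12; no side taken.
-/

namespace Literature.AlgebraicGeometry.Frobenioids

open CategoryTheory

noncomputable section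

namespace ArchFrd

universe v u

section General

variable {D : Type u} [Category.{v} D] (π : D ⥤ D0)

/-- **`D → D₀` is of (Galois-)SATURATED RC-iso-subanchor type**: every object `A_D` of `D` admits an RC-subanchor
`B_D`, a subgroup `G_D ⊆ Aut(B_D)` and a mono-minimal categorical quotient `B_D → A_D` of `B_D` by `G_D`
([FrdII] Def. 3.1 (v)(d)) which is moreover Galois-saturated for `π` (`ArchFrd.GaloisSaturated`: the tacit
hypothesis of the printed proof of Prop. 3.5 (i), p. 34). The repaired standing hypothesis of Prop. 3.5.
[cite: MochizukiFrdII2008, Def 3.1 (v) p.25] [cite: MochizukiFrdII2008, Prop 3.5 (i) p.34] -/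
@[mk_iff] structure IsOfSaturatedRCIsoSubanchorType : Prop where
  /-- every object is a mono-minimal categorical quotient of an RC-subanchor by a Galois-saturated subgroup -/
  isSaturatedRCIsoSubanchor : ∀ AD : D, ∃ (BD : D) (GD : Subgroup (Aut BD)) (fD : BD ⟶ AD),
    RC.IsRCSubanchor (baseRC π) BD ∧ IsMonoMinimalQuotient GD fD ∧ GaloisSaturated π fD GD

/-- **[FrdII] Prop. 3.5 (iii) for `G = N`, REPAIRED (Galois-saturated reading)**: if `D → D₀` is of saturated
RC-iso-subanchor type, then the non-rigidified angloid `N` is of RC-iso-subanchor type w.r.t. `N → C → D → D₀`.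
[cite: MochizukiFrdII2008, Prop 3.5 (iii) p.34] -/
def Prop35iiiR_N : Prop :=
  IsOfSaturatedRCIsoSubanchorType π →
    RC.IsOfRCIsoSubanchorType (N.toC π ⋙ PreFrobenioid.baseFunctor (C.toElem π) ⋙ baseRC π)

/-- **[FrdII] Prop. 3.5 (iii) for `G = R`, REPAIRED (Galois-saturated reading)**: if `D → D₀` is of saturated
RC-iso-subanchor type, then the rigidified angloid `R` is of RC-iso-subanchor type w.r.t. `R → C → D → D₀`.
[cite: MochizukiFrdII2008, Prop 3.5 (iii) p.34] -/
def Prop35iiiR_R : Prop :=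
  IsOfSaturatedRCIsoSubanchorType π →
    RC.IsOfRCIsoSubanchorType (R.toC π ⋙ PreFrobenioid.baseFunctor (C.toElem π) ⋙ baseRC π)

variable {π} in
/-- A base of saturated RC-iso-subanchor type is of RC-iso-subanchor type ([FrdII] Def. 3.1 (v)(d)): forget the
saturation. [cite: MochizukiFrdII2008, Def 3.1 (v) p.25] -/
theorem IsOfSaturatedRCIsoSubanchorType.isOfRCIsoSubanchorType (h : IsOfSaturatedRCIsoSubanchorType π) :
    RC.IsOfRCIsoSubanchorType (baseRC π) :=
  ⟨fun AD => by
    obtain ⟨BD, GD, fD, hB, hq, -⟩ := h.isSaturatedRCIsoSubanchor AD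
    exact ⟨BD, GD, fD, hB, hq⟩⟩

/-- **Saturation is needed over REAL objects only**: `D → D₀` is of saturated RC-iso-subanchor type iff it is of
RC-iso-subanchor type and every REAL object admits a Galois-saturated presentation (over a complex object every
presentation is saturated, `galoisSaturated_of_isComplex`). [cite: MochizukiFrdII2008, Prop 3.5 (i) p.34] -/
theorem isOfSaturatedRCIsoSubanchorType_iff_real :
    IsOfSaturatedRCIsoSubanchorType π ↔
      RC.IsOfRCIsoSubanchorType (baseRC π) ∧
        ∀ AD : D, (π.obj AD).IsReal → ∃ (BD : D) (GD : Subgroup (Aut BD)) (fD : BD ⟶ AD),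
          RC.IsRCSubanchor (baseRC π) BD ∧ IsMonoMinimalQuotient GD fD ∧ GaloisSaturated π fD GD := by
  refine ⟨fun h => ⟨h.isOfRCIsoSubanchorType, fun AD _ => h.isSaturatedRCIsoSubanchor AD⟩,
    fun ⟨hRC, hsat⟩ => ⟨fun AD => ?_⟩⟩
  rcases D0.isReal_or_isComplex (π.obj AD) with hA | hA
  · exact hsat AD hA
  · obtain ⟨BD, GD, fD, hB, hq⟩ := hRC.isRCIsoSubanchor AD
    exact ⟨BD, GD, fD, hB, hq, galoisSaturated_of_isComplex π fD GD hA⟩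

/-- **The repaired Prop. 3.5 (iii) for `N` HOLDS** over every base functor `π : D → D₀` (gen 2's
`prop35iii_N_of_saturated`: lift the saturated presentation of `A_D` to `N` along the quotient-lifting of
abc-iut-w4-d100; saturation supplies the phase twist over a real `A_D`). [cite: MochizukiFrdII2008, Prop 3.5 (iii) p.34] -/
theorem prop35iiiR_N_holds : Literature.AlgebraicGeometry.Frobenioids.ArchFrd.Prop35iiiR_N π := fun h =>
  prop35iii_N_of_saturated π h.isSaturatedRCIsoSubanchor

/-- `_holds` alias of `prop35iiiR_N_holds` under the statement's own name. [cite: MochizukiFrdII2008, Prop 3.5 (iii) p.34] -/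
theorem Prop35iiiR_N_holds : Literature.AlgebraicGeometry.Frobenioids.ArchFrd.Prop35iiiR_N π :=
  prop35iiiR_N_holds π

/-- **The repaired Prop. 3.5 (iii) for `R` HOLDS** over every base functor (the typed `R`-instance is even
unconditional: gen 2's `prop35iii_R_holds`). [cite: MochizukiFrdII2008, Prop 3.5 (iii) p.34] -/
theorem prop35iiiR_R_holds : Literature.AlgebraicGeometry.Frobenioids.ArchFrd.Prop35iiiR_R π := fun h =>
  prop35iii_R_holds π h.isOfRCIsoSubanchorType

/-- `_holds` alias of `prop35iiiR_R_holds` under the statement's own name. [cite: MochizukiFrdII2008, Prop 3.5 (iii) p.34] -/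
theorem Prop35iiiR_R_holds : Literature.AlgebraicGeometry.Frobenioids.ArchFrd.Prop35iiiR_R π :=
  prop35iiiR_R_holds π

/-- Under the repaired hypothesis the TYPED instance `Prop35iii_N π` holds outright.
[cite: MochizukiFrdII2008, Prop 3.5 (iii) p.34] -/
theorem prop35iii_N_of_isOfSaturatedRCIsoSubanchorType (h : IsOfSaturatedRCIsoSubanchorType π) :
    Literature.AlgebraicGeometry.Frobenioids.ArchFrd.Prop35iii_N π := fun _ =>
  prop35iii_N_of_saturated π h.isSaturatedRCIsoSubanchor

/-- **A base refuting the typed Prop. 3.5 (iii) for `N` is NOT of saturated RC-iso-subanchor type** — the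
refuting witnesses miss exactly the repaired hypothesis. [cite: MochizukiFrdII2008, Prop 3.5 (iii) p.34] -/
theorem not_isOfSaturatedRCIsoSubanchorType_of_not_prop35iii_N
    (h : ¬ Literature.AlgebraicGeometry.Frobenioids.ArchFrd.Prop35iii_N π) :
    ¬ IsOfSaturatedRCIsoSubanchorType π := fun hs =>
  h (prop35iii_N_of_isOfSaturatedRCIsoSubanchorType π hs)

/-- **Every base functor with purely complex image that is of RC-iso-subanchor type is of saturated
RC-iso-subanchor type** (saturation is void over complex objects). [cite: MochizukiFrdII2008, Prop 3.5 (i) p.34] -/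
theorem isOfSaturatedRCIsoSubanchorType_of_forall_isComplex (hc : ∀ d : D, (π.obj d).IsComplex)
    (hRC : RC.IsOfRCIsoSubanchorType (baseRC π)) : IsOfSaturatedRCIsoSubanchorType π :=
  ⟨fun AD => by
    obtain ⟨BD, GD, fD, hB, hq⟩ := hRC.isRCIsoSubanchor AD
    exact ⟨BD, GD, fD, hB, hq, galoisSaturated_of_isComplex π fD GD (hc AD)⟩⟩

end General

/-! ### The bases of record -/

/-- **THE base of [IUTchI] Ex. 3.4 (i)** — the one-morphism category at `Spec ℂ` (`ArchFrd.ptBase`) — **is of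
saturated RC-iso-subanchor type** (purely complex image; of RC-iso-subanchor type by gen 3's
`ptBase_isOfRCIsoSubanchorType`). [cite: MochizukiFrdII2008, Def 3.1 (v) p.25] [cite: Mochizuki2012, Ex 3.4 (i) p.80] -/
theorem isOfSaturatedRCIsoSubanchorType_ptBase : IsOfSaturatedRCIsoSubanchorType ptBase :=
  isOfSaturatedRCIsoSubanchorType_of_forall_isComplex ptBase (fun _ => rfl) ptBase_isOfRCIsoSubanchorType

/-- **The RC-standard base `T → D₀` of abc-iut-w5-d013 (at which the typed Prop. 3.5 (i) FAILS) IS of saturated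
RC-iso-subanchor type**: its one real object `a` has the saturated presentation `(b → a, Aut(b) ∋ τ ↦ conj)`
(gen 3's `T.isMonoMinimalQuotient_fHom_top`, `galoisSaturated_fHom_top`).
[cite: MochizukiFrdII2008, Prop 3.5 (i) p.34] -/
theorem P35iToy.isOfSaturatedRCIsoSubanchorType_toD0 :
    IsOfSaturatedRCIsoSubanchorType Literature.AlgebraicGeometry.Frobenioids.ArchFrd.P35iToy.toD0 := by
  refine (isOfSaturatedRCIsoSubanchorType_iff_real _).2 ⟨P35iToy.isOfRCIsoSubanchorType, fun AD hA => ?_⟩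
  cases AD
  · exact absurd (hA : D0.complex = D0.real) (by rintro ⟨⟩)
  · exact ⟨P35iToy.T.b, ⊤, Literature.AlgebraicGeometry.Frobenioids.ArchFrd.P35iToy.T.fHom, P35iToy.isRCSubanchor_b,
      P35iToy.T.isMonoMinimalQuotient_fHom_top, P35iToy.galoisSaturated_fHom_top⟩

/-- **The RC-standard base `S → D₀` of gen 3 (refuting the typed (iii) under every printed hypothesis of [FrdII]
§3–§4) is NOT of saturated RC-iso-subanchor type** — the witness misses the repaired hypothesis.
[cite: MochizukiFrdII2008, Prop 3.5 (iii) p.34] -/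
theorem P35iiiStd.not_isOfSaturatedRCIsoSubanchorType :
    ¬ IsOfSaturatedRCIsoSubanchorType Literature.AlgebraicGeometry.Frobenioids.ArchFrd.P35iiiStd.toD0 :=
  not_isOfSaturatedRCIsoSubanchorType_of_not_prop35iii_N _ P35iiiStd.not_prop35iii_N_std

/-- **The Galois-collapsing base `collapse : D₀ → D₀` of gen 2 / abc-iut-w4-d100 (refuting the typed (i) and
(iii)) is NOT of saturated RC-iso-subanchor type.** [cite: MochizukiFrdII2008, Prop 3.5 (iii) p.34] -/
theorem D0.not_isOfSaturatedRCIsoSubanchorType_collapse : ¬ IsOfSaturatedRCIsoSubanchorType D0.collapse :=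
  not_isOfSaturatedRCIsoSubanchorType_of_not_prop35iii_N _ not_prop35iii_N_collapse

/-- **Kernel record, packaged**: the repaired Prop. 3.5 (iii) holds for `N` and `R` over EVERY base functor, while
there is a base of RC-standard type violating the repaired hypothesis at which the typed (printed) statement fails
for `N`. [cite: MochizukiFrdII2008, Prop 3.5 (iii) p.34] -/
theorem prop35iiiR_holds_and_witness_misses :
    (∀ (D : Type u) [Category.{v} D] (π : D ⥤ D0),
        Literature.AlgebraicGeometry.Frobenioids.ArchFrd.Prop35iiiR_N π ∧
          Literature.AlgebraicGeometry.Frobenioids.ArchFrd.Prop35iiiR_R π) ∧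
      ∃ (D : Type) (_ : Category.{0} D) (π : D ⥤ D0), RC.IsOfRCStandardType (baseRC π) ∧
        ¬ IsOfSaturatedRCIsoSubanchorType π ∧ ¬ Literature.AlgebraicGeometry.Frobenioids.ArchFrd.Prop35iii_N π :=
  ⟨fun _ _ π => ⟨prop35iiiR_N_holds π, prop35iiiR_R_holds π⟩,
    ⟨P35iiiStd.S, inferInstance, Literature.AlgebraicGeometry.Frobenioids.ArchFrd.P35iiiStd.toD0,
      P35iiiStd.isOfRCStandardType, P35iiiStd.not_isOfSaturatedRCIsoSubanchorType, P35iiiStd.not_prop35iii_N_std⟩⟩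

end ArchFrd

end

end Literature.AlgebraicGeometry.Frobenioids
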